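import Mathlib
import HarnessLib
import Summits.NavierStokesRegularity.NavierStokesRegularity.Theses.QuarterLogPincer
import Summits.NavierStokesRegularity.NavierStokesRegularity.Theorems.QuarterLogPincerCubicRungEdge
import Summits.NavierStokesRegularity.NavierStokesRegularity.Theorems.QuarterLogPincerBeadCensusKernel
import Summits.NavierStokesRegularity.NavierStokesRegularity.Theorems.QuarterLogPincerEmberCensusKernel
import Summits.NavierStokesRegularity.NavierStokesRegularity.Theorems.QuarterLogPincerEmberCensusHotWitnessFar
import Summits.NavierStokesRegularity.NavierStokesRegularity.Theorems.QuarterLogPincerTypeIQuantSubcubicExpStubUniformScaledEnergy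
import Summits.NavierStokesRegularity.NavierStokesRegularity.Theorems.QuarterLogPincerSilencingCostDefs
import Summits.NavierStokesRegularity.NavierStokesRegularity.Theorems.QuarterLogPincerTypeIQuantSubcubicExpFrameTools
import Literature.Analysis.FluidPDE.PressureDecayEstimateProofs
import Literature.Analysis.FluidPDE.SereginEpsilonRegularityHigherHolds
import Literature.Analysis.FluidPDE.ChaeAsymptoticallySelfSimilarSmallness
import Literature.Analysis.FluidPDE.ClassicalTopPointCubic

/-!
# LINE `cold_smoothing` — crux `QuarterLogPincer.TypeIQuantSubcubicExp` (stmt-NavierStokesRegularity-24077, wall W7)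

seat ns-idea-7 · generation g13 (line g13-1) · lens «nearmiss» · target «DSS wall».
**No summit is proved by this line.**  It discharges, down to three PLUMBING stubs over TREE THEOREMS, the stub
E1b `EmberCensus.HotWitnessNear` of `Lines/ember_census.lean` v1.2 (the clock-NEAR half of the hot-witness
dichotomy E1; the clock-far half E1a is the tree theorem `EmberCensus.hotWitness_far`), and types the
`M`-capped regular aftermath Sa♭ that `silencing_cost` v1.3 / `smooth_silence` may take in place of Sa.

v1.1 (2026-08-29, same slug): + §5 — E2♭ `TerminalEmberM` (text of `ember_census` v1.2) DERIVED here by re-running the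
tree kernel `SilencingCost.terminalEmber_of_stubs` with Sa♭ in place of Sa: `terminalEmberM_of_stubsM :
RegularAftermathM → VorticalCentre → EnstrophyPersistence → EmberReadout → TerminalEmberM` (PROVED) and
`terminalEmberM_of_vortical_of_persistence` (Sa♭ supplied by `regularAftermathM_via_stubs`), i.e. E2♭ ⟸ {CS1–CS3, Sb,
Sc′} given the tree's `enstrophyPersistence_of_thickBoxSilencingCost` and `stub_emberReadout` (…SilencingCostKernel) —
the absolute cap `ε₀` of Sa is no longer anywhere in the E-chain.  Hygiene H1 of the critic folded (0 non-sorry warnings).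

## Near-miss of record, measured deficit, single input

NEAR-MISS: `ember_census` v1.1/v1.2 (critic PASS) asks E1 — «a violated candidate annulus has an ε-hot event in
its recent past» — and argued it in words through the Gustafson–Kang–Tsai `(p,q) = (∞,1)` local-energy ITERATION
(arXiv:math/0607114 Thm 1.1(i), region III) seeded by the tree's I1: `O(log(C(M)/ε₀))` halvings to reach the
Caffarelli–Kohn–Nirenberg threshold.  MEASURED DEFICIT: that iteration is not in the tree and its quantitative
form (regularity radius as a function of the seed) is only implicit in print — the critic sized E1 «M» on that
basis and nobody typed it.  SINGLE INPUT TO IMPROVE: the iteration is UNNECESSARY.  Because E1 lets the hotness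
threshold `ε` depend on `M` (its quantifier prefix is `∀ μ M ε₀, ∃ ε ≤ ε₀`), ONE application of the tree's PROVED
Seregin–Šverák pressure decay (`Literature.Analysis.FluidPDE.seregin_sverak_pressure_decay_holds`) at a ratio
`θ = θ(M)`, followed by the tree's PROVED ε-regularity lemma with all derivatives
(`Literature.Analysis.FluidPDE.seregin2014_lemma61_holds`, Seregin 2014 Lemma 6.1 = CKN Prop. 1 + NRŠ), closes
E1b:

* COLD ⇒ SMALL `C` AT EVERY SCALE (stub CS1 `ColdCube`, size S–M): if `√(T'−t)‖u(t,y)‖ ≤ ε` on `Q_ρ(z)` then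
  `∫∫_{Q_ρ}|u|³ ≤ ∫ (sup_{B_ρ}|u(t)|)·(∫_{B_ρ}|u(t)|²) dt ≤ C(M)ρ · ε∫_{z₁−ρ²}^{z₁}(T'−t)^{-1/2}dt ≤ 2εC(M)ρ²`
  (slice energy `≤ C(M)ρ` is the A-clause of the tree's PROVED I1 `ThinCascade.stub_uniformScaledEnergy` on the
  frame restricted to `[0,z₁]`; `√(T'−a) − √(T'−b) ≤ √(b−a)`), i.e. `cknC ρ z u ≤ 2εC(M)` — at EVERY `ρ` with
  `ρ² ≤ z₁`, no dependence on `A`.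
* BOUNDED `D` IN THE BALL GAUGE (stub CS2 `ColdPressureGauge`, size M): the D-clause of I1 is LITERALLY
  `cknD ρ z p̃ ≤ C(M)` for the gauge-shifted pressure `p̃(t,y) = p(t,y) − ⨍_{B_ρ(z₂)} p(t)`; `(u,p̃)` is again a
  classical, hence suitable, pair on `Q_ρ(z)` (tree: `isSuitableWeakSolutionInBall_of_classical'`,
  `isSuitableWeakSolutionOn_gauge_of_classical`).
* ONE PRESSURE STEP (KERNEL, proved here from the tree theorem): `D(θρ; p̃) ≤ c(θ·C(M) + θ⁻²·2εC(M))` and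
  `C(θρ) ≤ 2εC(M)` (CS1 again, at the smaller cold cylinder), so with `θ(M) := min(½, ε⋆/(4(c+1)C(M)))` and
  `ε ≤ ε₁(M) := ε⋆θ²/(4(c+1)C(M))` the pair is `ε⋆`-SMALL at scale `θρ`: `C(θρ) + D(θρ) < ε⋆`.
* SMALL ⇒ SMOOTH WITH CONSTANTS (stub CS3 `SmallEnergySmoothing`, size M): `C(r)+D(r) < ε⋆` for a pair suitable
  in `Q_r(z)` with `u` classical up to the vertex ⇒ `‖∇ʲu‖ ≤ c⋆ r^{-(j+1)}` on `[z₁ − r²/4, z₁] × B(z₂, r/2)`,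
  `j ≤ 2` (parabolic zoom `IsSuitableWeakSolutionInBall.zoom_radius` to the unit cylinder, `seregin2014_lemma61`,
  identification of the smooth representative with the classical `u`, closed time endpoints by continuity —
  `continuousWithinAt_iteratedFDeriv_slice`).

KERNEL (all proved here, no sorry outside the three stubs): `coldRegularity_of_stubs` (the package above:
`∀ M ≥ 1, ∃ ε₁ θ c⋆, …, cold Q_ρ(z) ⇒ C² bounds c⋆(θρ)^{-(j+1)} on Q_{θρ/2}(z)` up to the vertex), and
`hotWitnessNear_of_stubs : HotWitnessNear` (text VERBATIM = `EmberCensus.HotWitnessNear` of `Lines/ember_census.lean`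
v1.2; by name once the typer homes it): given a violated annulus at `t' ∈ [t₁ − s/32, t₁]`, `x` with
`R < |x−x₀| < M^{10μ}R`, if NO admissible hot event existed then `Q_r(t',x)` (`r = Γ√s`) would be ε-cold (each
of its points satisfies the admissibility constraints `t ≤ t₁`, `t₁−4r² ≤ t`, `T'−t ≤ 5r²` (clock-near
hypothesis `T'−t₁ ≤ r²`), `R−r ≤ |y−x₀| ≤ M^{10μ}R+r`, and the room clause `T'−t ≤ t` of `Hot`), hence by
`coldRegularity_of_stubs` `‖∇ʲu(t',x)‖ ≤ c⋆(θΓ√s)^{-(j+1)} ≤ M^{-3μ}s^{-(j+1)/2}` once `θΓ ≥ c⋆M^{3μ}+1`, i.e. the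
annulus WAS quiet — contradiction.  `Γ₁(μ,M) := (c⋆M^{3μ}+1)/θ(M)`, `ε := min(ε₀, ε₁(M))`.

Sa♭ `RegularAftermathM` (§R, PROVED here from the same three stubs: `regularAftermathM_of_stubs`): `silencing_cost`'s
Sa (`SilencingCost.RegularAftermath`, tree, BY NAME for `BoxBound`) with the cap `ε ≤ ε₁(M)` instead of an absolute
`ε₀` — exactly what `ember_census` v1.2's E2♭ `TerminalEmberM` consumes.  Early slab (clock at `s` beyond `σ/4`): the
rate is the speed `4M/σ` and the tree's `EmberCensus.norm_iteratedFDeriv_le_of_typeI_far` smooths; late slab: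
terminality makes `Q_{σ/4}(s,x)` ε-cold and the cold-regularity package smooths; `M₁(ε,M) = (C₀+C₁+C₂+1)(4M)³ +
c⋆(4/θ(M))³` (in fact independent of `ε`).  So the absolute-`ε₀` Sa of `silencing_cost` — whose mechanism needed the
GKT contraction ITERATION — is replaced, for every use the census makes of it, by three plumbing stubs.

bears_on: LADDER-NS W7 rung «R0-rate» `CubicRung.TypeIQuantCubicExp` via `ember_census` (E1b feeds
`hotWitness_of_far_of_near` ⇒ `HotWitness` ⇒ K2 ⇒ `FlarePersistence` ⇒ `BeadCensus` ⇒ (G2) R).  Why novel vs the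
crux's 17 lines: every previous appeal to ε-regularity on this crux (E1 v1/v1.1, Sa, Sa♯, `quiet_collar`) routes
through an ITERATION (GKT/CKN contraction, `O(log)` steps) or through compactness; this line observes that the
`M`-dependent threshold makes the FIRST pressure-decay step already land below `ε⋆` — the lever (five words):
«M-small coldness needs no iteration».  Cheapest falsifier: CS1 is an explicit Hölder computation — a classical
Type-I-rate solution with a cold cylinder `Q_ρ(z)`, `ρ² ≤ z₁`, and `cknC ρ z u > 2εC(M)` would have slice energy
`> C(M)ρ` somewhere, contradicting the PROVED I1: impossible; CS3 dies iff `seregin2014_lemma61`'s representative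
can differ from a classical `u` on a set of times of positive measure (it cannot: both are continuous).  The line is
PLUMBING by design; its content is the observation that E1b is tree-deep, not literature-deep.
Instrument row (pub-ns-dss, PREREG words, extends «outer-shell flare census»): per Type-I candidate run, at each
violated candidate annulus report `min` over the annulus of `θρ`-scale `C+D` (ball-gauge pressure) — COLD-SMALL =
`C(θρ)+D(θρ) < ε⋆` at every annulus point with no ε-hot event in `Q_r` (consistent); COLD-LARGE = a cold `Q_r` with
`C(ρ) > 2εC(M)` (kills CS1 ⇒ contradicts I1 ⇒ the run is not a classical Type-I-rate solution: a CODE check, not a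
mathematics check).
-/

set_option linter.dupNamespace false

noncomputable section

open MeasureTheory Set Function Filter Topology Metric
open scoped ENNReal NNReal Classical
open Literature.Analysis Literature.Analysis.FluidPDE
open Summit.NavierStokesRegularity.NavierStokesRegularity.Cruxes.TypeIQuantSubcubicExp.BeadCensus
open Summit.NavierStokesRegularity.NavierStokesRegularity.Cruxes.TypeIQuantSubcubicExp.EmberCensus
  (Hot Terminal HotWitnessNear TerminalEmberM norm_iteratedFDeriv_le_of_typeI_far continuousWithinAt_iteratedFDeriv_slice)

namespace Summit.NavierStokesRegularity.NavierStokesRegularity.Cruxes.TypeIQuantSubcubicExp.ColdSmoothing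

local notation "E3" => EuclideanSpace ℝ (Fin 3)

/-! ## §0 Frame abbreviations and coldness -/

/-- The crux frame: classical on `[0,T] × ℝ³` (`ν = 1`, unforced) with square-integrable derivatives of all
orders (= `TaoFrame`). -/
def Frame (T : ℝ) (u : ℝ → E3 → E3) (p : ℝ → E3 → ℝ) : Prop :=
  IsClassicalNSSolutionOn (Icc 0 T) 1 0 u p ∧
    ∀ m : ℕ, ∃ C : NNReal, ∀ t ∈ Icc 0 T, eLpNorm (iteratedFDeriv ℝ m (u t)) 2 volume ≤ C

/-- The virtual Type-I rate `‖u(t,x)‖ ≤ M (T+τ−t)^{-1/2}` on `[0,T]` (sup-rate gauge of the crux). -/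
def Rate (M T τ : ℝ) (u : ℝ → E3 → E3) : Prop :=
  ∀ t ∈ Icc 0 T, ∀ x : E3, ‖u t x‖ ≤ M * (T + τ - t) ^ (-(1 / 2 : ℝ))

/-- `ε`-COLD on a space-time set (virtual blow-up time `T'`): `√(T'−t)·‖u(t,y)‖ ≤ ε` at each of its points. -/
def ColdOn (ε T' : ℝ) (u : ℝ → E3 → E3) (Q : Set (ℝ × E3)) : Prop :=
  ∀ w ∈ Q, Real.sqrt (T' - w.1) * ‖u w.1 w.2‖ ≤ ε

theorem coldOn_mono {ε T' : ℝ} {u : ℝ → E3 → E3} {Q Q' : Set (ℝ × E3)} (h : ColdOn ε T' u Q)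
    (hQ : Q' ⊆ Q) : ColdOn ε T' u Q' := fun w hw => h w (hQ hw)

/-- The ball-gauge of the pressure at centre `x`, radius `ρ`: `p̃(t,y) = p(t,y) − ⨍_{B(x,ρ)} p(t)`. -/
def ballGauge (p : ℝ → E3 → ℝ) (x : E3) (ρ : ℝ) : ℝ → E3 → ℝ :=
  fun t y => p t y - ⨍ w in ball x ρ, p t w

/-! ## §1 The three stubs (plumbing over tree theorems) -/

/-- **CS1 — `ColdCube` (size S–M; Hölder + the PROVED I1).**  For `M ≥ 1` there is `C₁ = C₁(M) > 0`: in the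
frame with rate `M`, an `ε`-cold backward cylinder `Q_ρ(z)` with `ρ² ≤ z₁ ≤ T` has `cknC ρ z u ≤ C₁ε`.
Mechanism: `∫∫_{Q_ρ(z)}|u|³ ≤ ∫_{z₁−ρ²}^{z₁} (sup_{B_ρ(z₂)}|u(t)|)(∫_{B_ρ(z₂)}|u(t)|²)dt`; the slice energy is
`≤ C(M)ρ` by the A-clause of `ThinCascade.stub_uniformScaledEnergy` (tree, PROVED) applied to the frame
restricted to `[0,z₁]` (`ThinCascade.frame_restrict`, `typeI_restrict`) at vertex `(x,r) = (z₂,ρ)`; coldness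
gives `sup_{B_ρ}|u(t)| ≤ ε(T+τ−t)^{-1/2}` and `∫_{z₁−ρ²}^{z₁}(T+τ−t)^{-1/2}dt = 2(√(T+τ−z₁+ρ²) − √(T+τ−z₁)) ≤ 2ρ`;
so `cknC ρ z u = ρ⁻²∫∫|u|³ ≤ 2C(M)ε`; `C₁ := 2C(M)+1`.  Why it might fail: not as mathematics (Tonelli on the
product set, measurability from classical smoothness).  Sources: I1 =
`Theorems/QuarterLogPincerTypeIQuantSubcubicExpStubUniformScaledEnergy.lean`; [CaffarelliKohnNirenberg1982 §2]. -/
def ColdCube : Prop :=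
  ∀ M : ℝ, 1 ≤ M → ∃ C₁ : ℝ, 0 < C₁ ∧
    ∀ (T τ : ℝ) (u : ℝ → E3 → E3) (p : ℝ → E3 → ℝ), Frame T u p → 0 < τ → Rate M T τ u →
      ∀ (ε : ℝ) (z : ℝ × E3) (ρ : ℝ), 0 ≤ ε → 0 < ρ → ρ ^ 2 ≤ z.1 → z.1 ≤ T →
        ColdOn ε (T + τ) u (parabolicCylinder ρ z) →
        cknC ρ z u ≤ ENNReal.ofReal (C₁ * ε)

theorem stub_coldCube : ColdCube := by
  sorry

/-- **CS2 — `ColdPressureGauge` (size M; the PROVED I1, D-clause, read in CKN variables).**  For `M ≥ 1` there is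
`C₂ = C₂(M) > 0`: in the frame with rate `M`, for every backward cylinder `Q_ρ(z)` with `ρ² ≤ z₁ ≤ T`, the pair
`(u, p̃)` with the BALL-GAUGED pressure `p̃ = ballGauge p z₂ ρ` is a suitable weak solution in every parabolic ball
`Q_{ρ'}(z)`, `0 < ρ' ≤ ρ` (Albritton–Barker class `IsSuitableWeakSolutionInBall`), and `cknD ρ z p̃ ≤ C₂`.
Mechanism: `∇p̃ = ∇p` and `t ↦ ⨍_{B}p(t)` is smooth, so `(u,p̃)` is classical on the closed cylinder
(`⊂ [0,T] × ℝ³` since `z₁ − ρ² ≥ 0`): `isSuitableWeakSolutionInBall_of_classical'` /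
`isSuitableWeakSolutionOn_gauge_of_classical` (tree) with the energy, gradient and `L^{3/2}` classes from
continuity on a compact set; the bound is the D-clause of `ThinCascade.stub_uniformScaledEnergy` at vertex `z₁`
(frame restricted to `[0,z₁]`), radius `ρ`, centre `z₂`: `∫_{z₁−ρ²}^{z₁}∫_{B_ρ}|p − ⨍_{B_ρ}p|^{3/2} ≤ C(M)ρ²`, i.e.
`cknD ρ z p̃ ≤ C(M)` (`Ioo ⊂ Icc`, iterated = product integral by Tonelli).  Why it might fail: not as
mathematics.  Sources: I1 (tree); [Lin1998] (the `L^{3/2}` pressure class); CKN 1982 §2. -/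
def ColdPressureGauge : Prop :=
  ∀ M : ℝ, 1 ≤ M → ∃ C₂ : ℝ, 0 < C₂ ∧
    ∀ (T τ : ℝ) (u : ℝ → E3 → E3) (p : ℝ → E3 → ℝ), Frame T u p → 0 < τ → Rate M T τ u →
      ∀ (z : ℝ × E3) (ρ : ℝ), 0 < ρ → ρ ^ 2 ≤ z.1 → z.1 ≤ T →
        (∀ ρ' : ℝ, 0 < ρ' → ρ' ≤ ρ → IsSuitableWeakSolutionInBall ρ' z u (ballGauge p z.2 ρ)) ∧
        cknD ρ z (ballGauge p z.2 ρ) ≤ ENNReal.ofReal C₂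

theorem stub_coldPressureGauge : ColdPressureGauge := by
  sorry

/-- **CS3 — `SmallEnergySmoothing` (size M; the PROVED `seregin2014_lemma61` + parabolic zoom).**  There are absolute
`ε⋆ > 0` and `c⋆ ≥ 1`: if `u` is classical on `[0,T] × ℝ³` (any pressure `p`), `Q_r(z)` is a backward cylinder with
`r² ≤ z₁ ≤ T`, `(u,q)` is a suitable weak solution in the parabolic ball `Q_r(z)` for SOME pressure `q`, and
`cknC r z u + cknD r z q < ε⋆`, then `‖∇ʲu(t,x)‖ ≤ c⋆ r^{-(j+1)}` for `t ∈ [z₁ − r²/4, z₁]`, `x ∈ B(z₂, r/2)`, `j ≤ 2`.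
Mechanism: zoom `U(s,y) = r·u(z₁+r²s, z₂+ry)`, `P = r²q(…)` (`IsSuitableWeakSolutionInBall.zoom_radius`, tree):
`∫_{Q₁}(|U|³+|P|^{3/2}) = cknC r z u + cknD r z q < ε⋆ := ε₀` of `seregin2014_lemma61_holds` (tree, PROVED) ⇒ a
representative `W` of `U` on `Q(1/2)` with `‖∇ᵏW‖ ≤ c₀ k`; `U` is continuous (classical), so `U = W` on `Q(1/2)`
(two continuous functions equal a.e. on an open set), the bounds transfer to `U` on the open cylinder and to its
closed time endpoints by `continuousWithinAt_iteratedFDeriv_slice` (tree); unzoom: `‖∇ʲu‖ = r^{-(j+1)}‖∇ʲU‖`;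
`c⋆ := max(1, c₀ 0, c₀ 1, c₀ 2)`.  Why it might fail: not as mathematics (`iteratedFDeriv` of an affine
precomposition — the same algebra as `limit_silence`/`smooth_silence` L♯1).  Sources: [Seregin2014 Lemma 6.1,
PDF p. 90]; CKN 1982 Prop. 1; Nečas–Růžička–Šverák 1996 Prop. 2.1; tree `SereginEpsilonRegularityHigherHolds`. -/
def SmallEnergySmoothing : Prop :=
  ∃ εs cs : ℝ, 0 < εs ∧ 1 ≤ cs ∧
    ∀ (T : ℝ) (u : ℝ → E3 → E3) (p q : ℝ → E3 → ℝ), Frame T u p →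
      ∀ (z : ℝ × E3) (r : ℝ), 0 < r → r ^ 2 ≤ z.1 → z.1 ≤ T →
        IsSuitableWeakSolutionInBall r z u q →
        cknC r z u + cknD r z q < ENNReal.ofReal εs →
        ∀ t ∈ Icc (z.1 - (r / 2) ^ 2) z.1, ∀ x ∈ ball z.2 (r / 2), ∀ j : ℕ, j ≤ 2 →
          ‖iteratedFDeriv ℝ j (u t) x‖ ≤ cs * r ^ (-((j : ℝ) + 1))

theorem stub_smallEnergySmoothing : SmallEnergySmoothing := by
  sorry

/-! ## §2 KERNEL — one pressure step: cold cylinders are quantitatively regular -/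

/-- **Cold regularity package** (PROVED from CS1–CS3 and the tree's `seregin_sverak_pressure_decay_holds`): for
`M ≥ 1` there are `ε₁(M) > 0`, `θ(M) ∈ (0,1]`, `c⋆ ≥ 1` such that an `ε`-cold cylinder `Q_ρ(z)` (`ε ≤ ε₁`,
`ρ² ≤ z₁ ≤ T`) of a frame solution with rate `M` carries `‖∇ʲu‖ ≤ c⋆(θρ)^{-(j+1)}` on
`[z₁ − (θρ/2)², z₁] × B(z₂, θρ/2)`, `j ≤ 2`. -/
theorem coldRegularity_of_stubs (h1 : ColdCube) (h2 : ColdPressureGauge) (h3 : SmallEnergySmoothing) :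
    ∀ M : ℝ, 1 ≤ M → ∃ ε₁ θ cs : ℝ, 0 < ε₁ ∧ 0 < θ ∧ θ ≤ 1 ∧ 1 ≤ cs ∧
      ∀ (T τ : ℝ) (u : ℝ → E3 → E3) (p : ℝ → E3 → ℝ), Frame T u p → 0 < τ → Rate M T τ u →
        ∀ (ε : ℝ) (z : ℝ × E3) (ρ : ℝ), 0 ≤ ε → ε ≤ ε₁ → 0 < ρ → ρ ^ 2 ≤ z.1 → z.1 ≤ T →
          ColdOn ε (T + τ) u (parabolicCylinder ρ z) →
          ∀ t ∈ Icc (z.1 - (θ * ρ / 2) ^ 2) z.1, ∀ x ∈ ball z.2 (θ * ρ / 2), ∀ j : ℕ, j ≤ 2 →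
            ‖iteratedFDeriv ℝ j (u t) x‖ ≤ cs * (θ * ρ) ^ (-((j : ℝ) + 1)) := by
  intro M hM
  obtain ⟨C₁, hC₁, H1⟩ := h1 M hM
  obtain ⟨C₂, hC₂, H2⟩ := h2 M hM
  obtain ⟨εs, cs, hεs, hcs, H3⟩ := h3
  obtain ⟨c, Hc⟩ := seregin_sverak_pressure_decay_holds
  set K : ℝ := (c : ℝ) + 1 with hK
  have hc0 : 0 ≤ (c : ℝ) := c.coe_nonneg
  have hK1 : 1 ≤ K := by rw [hK]; linarith
  have hK0 : 0 < K := by linarith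
  -- the ratio `θ(M)` and the cap `ε₁(M)`
  set θ : ℝ := min (1 / 2) (εs / (4 * K * C₂)) with hθ
  have hθpos : 0 < θ := by
    rw [hθ]; refine lt_min (by norm_num) ?_; positivity
  have hθhalf : θ ≤ 1 / 2 := min_le_left _ _
  have hθ1 : θ ≤ 1 := hθhalf.trans (by norm_num)
  have hθC₂ : θ * (4 * K * C₂) ≤ εs := by
    have : θ ≤ εs / (4 * K * C₂) := min_le_right _ _
    rwa [le_div_iff₀ (by positivity)] at this
  set ε₁ : ℝ := εs * θ ^ 2 / (4 * K * C₁) with hε₁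
  have hε₁pos : 0 < ε₁ := by rw [hε₁]; positivity
  refine ⟨ε₁, θ, cs, hε₁pos, hθpos, hθ1, hcs, ?_⟩
  intro T τ u p hframe hτ hrate ε z ρ hε hεle hρ hρz hzT hcold
  -- the smaller cylinder `Q_{θρ}(z)` is cold too
  have hθρ : 0 < θ * ρ := mul_pos hθpos hρ
  have hθρle : θ * ρ ≤ ρ := by nlinarith
  have hsub : parabolicCylinder (θ * ρ) z ⊆ parabolicCylinder ρ z := parabolicCylinder_mono hθρ.le hθρle z
  have hcold' : ColdOn ε (T + τ) u (parabolicCylinder (θ * ρ) z) := coldOn_mono hcold hsub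
  have hθρz : (θ * ρ) ^ 2 ≤ z.1 := le_trans (by nlinarith) hρz
  -- CS1 at both scales, CS2 at scale `ρ`
  have hC_small : cknC (θ * ρ) z u ≤ ENNReal.ofReal (C₁ * ε) :=
    H1 T τ u p hframe hτ hrate ε z (θ * ρ) hε hθρ hθρz hzT hcold'
  have hC_big : cknC ρ z u ≤ ENNReal.ofReal (C₁ * ε) := H1 T τ u p hframe hτ hrate ε z ρ hε hρ hρz hzT hcold
  obtain ⟨hball, hD⟩ := H2 T τ u p hframe hτ hrate z ρ hρ hρz hzT
  set q : ℝ → E3 → ℝ := ballGauge p z.2 ρ with hq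
  have hIn : IsSuitableWeakSolutionInBall (θ * ρ) z u q := hball (θ * ρ) hθρ hθρle
  have hInρ : IsSuitableWeakSolutionInBall ρ z u q := hball ρ hρ le_rfl
  -- ONE pressure-decay step (tree theorem, Seregin–Šverák (as13))
  have hdist : IsDistributionalNSSolutionOn (parabolicCylinderOpens ρ z) 1 0 u q := hInρ.1.distributional
  have hstep := Hc (parabolicCylinderOpens ρ z) u q hdist z ρ (θ * ρ) hθρ hθρle (fun w hw => hw)
  have hratio : θ * ρ / ρ = θ := by field_simp
  have hratio' : (ρ / (θ * ρ)) ^ 2 = 1 / θ ^ 2 := by field_simp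
  rw [hratio, hratio'] at hstep
  -- assemble the smallness `C(θρ) + D(θρ) < ε⋆`
  have hA : C₁ * ε ≤ εs / 16 := by
    have h1' : C₁ * ε ≤ C₁ * ε₁ := mul_le_mul_of_nonneg_left hεle hC₁.le
    have h2' : C₁ * ε₁ = εs * θ ^ 2 / (4 * K) := by rw [hε₁]; field_simp
    have h3' : εs * θ ^ 2 / (4 * K) ≤ εs * (1 / 2) ^ 2 / (4 * 1) := by
      apply div_le_div₀ (by positivity) ?_ (by norm_num) (by linarith)
      exact mul_le_mul_of_nonneg_left (pow_le_pow_left₀ hθpos.le hθhalf 2) hεs.le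
    linarith
  have hB : (c : ℝ) * (θ * C₂) ≤ εs / 4 := by
    have : (c : ℝ) * (θ * C₂) ≤ K * (θ * C₂) := mul_le_mul_of_nonneg_right (by linarith) (by positivity)
    nlinarith
  have hC : (c : ℝ) * (1 / θ ^ 2 * (C₁ * ε)) ≤ εs / 4 := by
    have h1' : 1 / θ ^ 2 * (C₁ * ε) ≤ 1 / θ ^ 2 * (C₁ * ε₁) :=
      mul_le_mul_of_nonneg_left (mul_le_mul_of_nonneg_left hεle hC₁.le) (by positivity)
    have h2' : 1 / θ ^ 2 * (C₁ * ε₁) = εs / (4 * K) := by rw [hε₁]; field_simp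
    have h3' : (c : ℝ) * (εs / (4 * K)) ≤ K * (εs / (4 * K)) :=
      mul_le_mul_of_nonneg_right (by linarith) (by positivity)
    have h4' : K * (εs / (4 * K)) = εs / 4 := by field_simp
    calc (c : ℝ) * (1 / θ ^ 2 * (C₁ * ε)) ≤ (c : ℝ) * (εs / (4 * K)) := by
          apply mul_le_mul_of_nonneg_left (h1'.trans h2'.le) hc0
      _ ≤ εs / 4 := by linarith
  have hsmall : cknC (θ * ρ) z u + cknD (θ * ρ) z q < ENNReal.ofReal εs := by
    have hCε : 0 ≤ C₁ * ε := mul_nonneg hC₁.le hε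
    have hD' : cknD (θ * ρ) z q ≤
        ENNReal.ofReal ((c : ℝ) * (θ * C₂ + 1 / θ ^ 2 * (C₁ * ε))) := by
      refine hstep.trans ?_
      have e1 : ENNReal.ofReal θ * cknD ρ z q ≤ ENNReal.ofReal (θ * C₂) := by
        rw [ENNReal.ofReal_mul hθpos.le]
        gcongr
      have e2 : ENNReal.ofReal (1 / θ ^ 2) * cknC ρ z u ≤ ENNReal.ofReal (1 / θ ^ 2 * (C₁ * ε)) := by
        rw [ENNReal.ofReal_mul (by positivity)]
        gcongr
      calc (c : ℝ≥0∞) * (ENNReal.ofReal θ * cknD ρ z q + ENNReal.ofReal (1 / θ ^ 2) * cknC ρ z u)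
          ≤ (c : ℝ≥0∞) * (ENNReal.ofReal (θ * C₂) + ENNReal.ofReal (1 / θ ^ 2 * (C₁ * ε))) := by
            gcongr (c : ℝ≥0∞) * ?_
            exact add_le_add e1 e2
        _ = ENNReal.ofReal ((c : ℝ) * (θ * C₂ + 1 / θ ^ 2 * (C₁ * ε))) := by
            rw [← ENNReal.ofReal_add (by positivity) (by positivity), ← ENNReal.ofReal_coe_nnreal,
              ← ENNReal.ofReal_mul hc0]
    calc cknC (θ * ρ) z u + cknD (θ * ρ) z q
        ≤ ENNReal.ofReal (C₁ * ε) + ENNReal.ofReal ((c : ℝ) * (θ * C₂ + 1 / θ ^ 2 * (C₁ * ε))) :=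
          add_le_add hC_small hD'
      _ = ENNReal.ofReal (C₁ * ε + (c : ℝ) * (θ * C₂ + 1 / θ ^ 2 * (C₁ * ε))) := by
          rw [← ENNReal.ofReal_add hCε (by positivity)]
      _ < ENNReal.ofReal εs := by
          rw [ENNReal.ofReal_lt_ofReal_iff hεs]
          nlinarith [mul_add (c : ℝ) (θ * C₂) (1 / θ ^ 2 * (C₁ * ε))]
  -- ε-regularity with all derivatives at scale `θρ`
  exact H3 T u p q hframe z (θ * ρ) hθρ hθρz hzT hIn hsmall

/-! ## §3 TARGET E1b — the clock-near hot witness, BY (verbatim) NAME -/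

/-! **E1b `HotWitnessNear`** — BY NAME (v1.1): `EmberCensus.HotWitnessNear`, homed by typer g38 in `…EmberCensusDefs`
(section SplitV12, 2026-08-29 09:09Z) with text byte-identical to `Lines/ember_census.lean` v1.2 / this file's v1 copy. -/

/-- Scale algebra: `c⋆ (θΓ√s)^{-(j+1)} ≤ M^{-3μ} s^{-(j+1)/2}` once `θΓ ≥ c⋆M^{3μ} + 1`. -/
theorem scale_bound {cs θ Γ s M μ : ℝ} (hcs : 1 ≤ cs) (_hθ : 0 < θ) (hs : 0 < s) (hM : 1 ≤ M) (hμ : 0 < μ)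
    (hΓ : cs * M ^ (3 * μ) + 1 ≤ θ * Γ) (j : ℕ) :
    cs * (θ * (Γ * Real.sqrt s)) ^ (-((j : ℝ) + 1)) ≤ M ^ (-(3 * μ)) * s ^ (-(((j : ℝ) + 1) / 2)) := by
  have hM0 : 0 < M := by linarith
  have hMμ : 1 ≤ M ^ (3 * μ) := Real.one_le_rpow hM (by linarith)
  have hL : 1 ≤ θ * Γ := by nlinarith
  have hθΓ0 : 0 < θ * Γ := by linarith
  have hsq : 0 < Real.sqrt s := Real.sqrt_pos.2 hs
  -- split the power
  have hsplit : (θ * (Γ * Real.sqrt s)) ^ (-((j : ℝ) + 1)) =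
      (θ * Γ) ^ (-((j : ℝ) + 1)) * s ^ (-(((j : ℝ) + 1) / 2)) := by
    rw [show θ * (Γ * Real.sqrt s) = (θ * Γ) * Real.sqrt s by ring,
      Real.mul_rpow hθΓ0.le hsq.le, Real.sqrt_eq_rpow, ← Real.rpow_mul hs.le]
    congr 2; ring
  rw [hsplit, ← mul_assoc]
  refine mul_le_mul_of_nonneg_right ?_ (Real.rpow_nonneg hs.le _)
  -- `cs (θΓ)^{-(j+1)} ≤ M^{-3μ}`
  have hpow : cs * M ^ (3 * μ) ≤ (θ * Γ) ^ ((j : ℝ) + 1) := by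
    have e : ((j : ℝ) + 1) = ((j + 1 : ℕ) : ℝ) := by push_cast; ring
    rw [e, Real.rpow_natCast]
    exact (le_trans (by linarith) (le_self_pow₀ hL (Nat.succ_ne_zero j)))
  have hP0 : 0 < (θ * Γ) ^ ((j : ℝ) + 1) := Real.rpow_pos_of_pos hθΓ0 _
  have hQ0 : 0 < cs * M ^ (3 * μ) := by positivity
  rw [Real.rpow_neg hθΓ0.le, Real.rpow_neg hM0.le]
  calc cs * ((θ * Γ) ^ ((j : ℝ) + 1))⁻¹ = cs / (θ * Γ) ^ ((j : ℝ) + 1) := by rw [div_eq_mul_inv]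
    _ ≤ cs / (cs * M ^ (3 * μ)) := div_le_div_of_nonneg_left (by linarith) hQ0 hpow
    _ = (M ^ (3 * μ))⁻¹ := by field_simp

/-- **E1b from the stubs** (KERNEL): the clock-near hot witness. -/
theorem hotWitnessNear_of_stubs (h1 : ColdCube) (h2 : ColdPressureGauge) (h3 : SmallEnergySmoothing) :
    HotWitnessNear := by
  intro μ M ε₀ hμ hM hε₀
  obtain ⟨ε₁, θ, cs, hε₁, hθ, hθ1, hcs, HR⟩ := coldRegularity_of_stubs h1 h2 h3 M hM
  have hM0 : 0 < M := by linarith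
  have hMμ : 1 ≤ M ^ (3 * μ) := Real.one_le_rpow hM (by linarith)
  refine ⟨min ε₀ ε₁, lt_min hε₀ hε₁, min_le_left _ _, ?_⟩
  set Γ₁ : ℝ := (cs * M ^ (3 * μ) + 1) / θ with hΓ₁
  have hΓ₁θ : θ * Γ₁ = cs * M ^ (3 * μ) + 1 := by rw [hΓ₁]; field_simp
  have hΓ₁1 : 1 ≤ Γ₁ := by
    rw [hΓ₁, le_div_iff₀ hθ]; nlinarith
  refine ⟨Γ₁, hΓ₁1, ?_⟩
  intro Γ hΓ T τ u p hframe hτ hrate a t₁ x₀ k R ht₁ hroom hR₁ hR₂ hnear hviol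
  by_contra hno
  apply hviol
  intro t' ht' x hxR hxR' j hj
  -- the scale
  set s : ℝ := levelScale a t₁ (k + 1) with hs
  have hspos : 0 < s := by rw [hs, levelScale]; exact mul_pos ht₁.1 (Real.exp_pos _)
  set r : ℝ := Γ * Real.sqrt s with hr
  have hΓ1 : 1 ≤ Γ := hΓ₁1.trans hΓ
  have hsq : 0 < Real.sqrt s := Real.sqrt_pos.2 hspos
  have hrpos : 0 < r := mul_pos (by linarith) hsq
  have hsr : s ≤ r ^ 2 := by
    have : Real.sqrt s ≤ r := by rw [hr]; nlinarith
    calc s = Real.sqrt s ^ 2 := (Real.sq_sqrt hspos.le).symm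
      _ ≤ r ^ 2 := pow_le_pow_left₀ hsq.le this 2
  -- `Q_r(t',x)` is ε-cold, else an admissible hot event exists
  have hcold : ColdOn (min ε₀ ε₁) (T + τ) u (parabolicCylinder r (t', x)) := by
    intro w hw
    rw [parabolicCylinder, mem_prod, mem_Ioo, mem_ball] at hw
    obtain ⟨⟨hw1, hw2⟩, hw3⟩ := hw
    by_contra hhot
    push Not at hhot
    have hwy : ‖w.2 - x‖ < r := by rwa [← dist_eq_norm]
    apply hno
    refine ⟨w.2, w.1, ⟨?_, hhot⟩, ?_, ?_, ?_, ?_, ?_⟩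
    · -- room clause of `Hot`: `T+τ−w.1 ≤ w.1`
      nlinarith [ht'.1, ht'.2]
    · linarith [ht'.2]
    · nlinarith [ht'.1]
    · nlinarith [ht'.1, ht'.2]
    · have : ‖x - x₀‖ ≤ ‖w.2 - x₀‖ + ‖w.2 - x‖ := by
        calc ‖x - x₀‖ = ‖(w.2 - x₀) - (w.2 - x)‖ := by congr 1; abel
          _ ≤ ‖w.2 - x₀‖ + ‖w.2 - x‖ := norm_sub_le _ _
      linarith
    · have : ‖w.2 - x₀‖ ≤ ‖w.2 - x‖ + ‖x - x₀‖ := by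
        calc ‖w.2 - x₀‖ = ‖(w.2 - x) + (x - x₀)‖ := by congr 1; abel
          _ ≤ ‖w.2 - x‖ + ‖x - x₀‖ := norm_add_le _ _
      linarith
  -- cold regularity at vertex `(t',x)`, radius `r`
  have hrt' : r ^ 2 ≤ (t', x).1 := by
    show r ^ 2 ≤ t'; nlinarith [ht'.1]
  have ht'T : (t', x).1 ≤ T := by show t' ≤ T; linarith [ht'.2, ht₁.2]
  have hsq0 : 0 ≤ (θ * r / 2) ^ 2 := sq_nonneg _
  have hmem : t' ∈ Icc (t' - (θ * r / 2) ^ 2) t' := ⟨by linarith, le_rfl⟩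
  have hballx : x ∈ ball x (θ * r / 2) := mem_ball_self (by positivity)
  have hreg := HR T τ u p hframe hτ hrate (min ε₀ ε₁) (t', x) r (le_min hε₀.le hε₁.le) (min_le_right _ _)
    hrpos hrt' ht'T hcold t' hmem x hballx j hj
  refine hreg.trans ?_
  have hθΓ : cs * M ^ (3 * μ) + 1 ≤ θ * Γ := by
    rw [← hΓ₁θ]; exact mul_le_mul_of_nonneg_left hΓ hθ.le
  simpa [hr] using scale_bound hcs hθ hspos hM hμ hθΓ j


/-! ## §R TARGET Sa♭ — the `M`-capped regular aftermath (interface for `silencing_cost` v1.3 / `smooth_silence`) -/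

/-- **Sa♭ `RegularAftermathM`** — `SilencingCost.RegularAftermath` (tree `…QuarterLogPincerSilencingCostDefs`, text of
record) with the hotness cap allowed to depend on `M`: `∀ M ≥ 1, ∃ ε₁(M) > 0, ∀ ε ∈ (0,ε₁], ∃ M₁ ≥ 1, ∀ K ≥ 1, …`
(body VERBATIM = Sa's, with `SilencingCost.BoxBound` BY NAME).  This is the form `ember_census` v1.2's E2♭
`TerminalEmberM` consumes (K2 fixes `M` first); `silencing_cost` v1.3 = `terminalEmberM_of_stubs` with Sa♭ in place
of Sa (custodial, same kernel).  PROVED below from CS1–CS3 (`regularAftermathM_of_stubs`); Sa ⇒ Sa♭ trivially. -/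
def RegularAftermathM : Prop :=
  ∀ M : ℝ, 1 ≤ M → ∃ ε₁ : ℝ, 0 < ε₁ ∧ ∀ ε : ℝ, 0 < ε → ε ≤ ε₁ → ∃ M₁ : ℝ, 1 ≤ M₁ ∧ ∀ K : ℝ, 1 ≤ K →
    ∀ (T τ : ℝ) (u : ℝ → E3 → E3) (p : ℝ → E3 → ℝ),
      (IsClassicalNSSolutionOn (Icc 0 T) 1 0 u p ∧
          ∀ m : ℕ, ∃ C : NNReal, ∀ t ∈ Icc 0 T, eLpNorm (iteratedFDeriv ℝ m (u t)) 2 volume ≤ C) →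
        0 < τ →
        (∀ t ∈ Icc 0 T, ∀ x : E3, ‖u t x‖ ≤ M * (T + τ - t) ^ (-(1 / 2 : ℝ))) →
        ∀ (t₁ : ℝ) (y : E3) (t : ℝ), t₁ ∈ Ioc 0 T → t ≤ t₁ →
          Hot ε (T + τ) u y t → Terminal K ε (T + τ) t₁ u y t →
          SilencingCost.BoxBound M₁ (Real.sqrt (T + τ - t)) u y (Icc t t₁) (2 * K * Real.sqrt (T + τ - t))

/-- Sa ⇒ Sa♭ (weakening of the quantifier prefix). -/
theorem regularAftermathM_of_regularAftermath (h : SilencingCost.RegularAftermath) : RegularAftermathM := by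
  intro M hM
  obtain ⟨ε₀, hε₀, H⟩ := h
  refine ⟨ε₀, hε₀, fun ε hε hεle => ?_⟩
  obtain ⟨M₁, hM₁, H'⟩ := H ε M hε hεle hM
  exact ⟨M₁, hM₁, H'⟩

/-- The `L²` clause of the frame (order `0` of the Sobolev clause). -/
theorem l2_of_frame {T : ℝ} {u : ℝ → E3 → E3} {p : ℝ → E3 → ℝ} (hframe : Frame T u p) :
    ∃ K : NNReal, ∀ t ∈ Icc 0 T, eLpNorm (u t) 2 volume ≤ K := by
  obtain ⟨K, hK⟩ := hframe.2 0
  refine ⟨K, fun t' ht' => ?_⟩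
  have e : eLpNorm (u t') 2 volume = eLpNorm (iteratedFDeriv ℝ 0 (u t')) 2 volume :=
    eLpNorm_congr_norm_ae (Eventually.of_forall fun x => (norm_iteratedFDeriv_zero (𝕜 := ℝ)).symm)
  rw [e]; exact hK t' ht'

/-- Power algebra: `(a σ)^{-(j+1)} = a^{-(j+1)} σ^{-(j+1)}` with `a^{-(j+1)} = (1/a)^{j+1}` (nat power). -/
theorem rpow_neg_succ_mul {a σ : ℝ} (ha : 0 < a) (hσ : 0 < σ) (j : ℕ) :
    (a * σ) ^ (-((j : ℝ) + 1)) = (1 / a) ^ (j + 1) * σ ^ (-((j : ℝ) + 1)) := by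
  rw [Real.mul_rpow ha.le hσ.le]
  congr 1
  rw [Real.rpow_neg ha.le, show ((j : ℝ) + 1) = ((j + 1 : ℕ) : ℝ) by push_cast; ring, Real.rpow_natCast,
    one_div, inv_pow]

/-- **Sa♭ from the stubs** (KERNEL).  Early slab (clock at `s` beyond `σ/4`): the rate is the speed `4M/σ` and the
tree's `EmberCensus.norm_iteratedFDeriv_le_of_typeI_far` smooths; late slab (clock `≤ σ/4`): terminality makes the
backward cylinder `Q_{σ/4}(s,x)` ε-cold (every point of it is later than `t`, within `4Kσ` of `y`, with clock
`≤ σ/2`, and satisfies the room clause), so `coldRegularity_of_stubs` smooths.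
`M₁ := (C₀+C₁+C₂+1)(4M)³ + c⋆(4/θ)³`. -/
theorem regularAftermathM_of_stubs (h1 : ColdCube) (h2 : ColdPressureGauge) (h3 : SmallEnergySmoothing) :
    RegularAftermathM := by
  intro M hM
  obtain ⟨ε₁, θ, cs, hε₁, hθ, hθ1, hcs, HR⟩ := coldRegularity_of_stubs h1 h2 h3 M hM
  obtain ⟨C₀, hC₀0, hC₀⟩ := norm_iteratedFDeriv_le_of_typeI_far 0
  obtain ⟨C₁, hC₁0, hC₁⟩ := norm_iteratedFDeriv_le_of_typeI_far 1
  obtain ⟨C₂, hC₂0, hC₂⟩ := norm_iteratedFDeriv_le_of_typeI_far 2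
  have hM0 : 0 < M := by linarith
  set Cs : ℝ := C₀ + C₁ + C₂ with hCs
  have hCs0 : 0 ≤ Cs := by rw [hCs]; positivity
  refine ⟨ε₁, hε₁, fun ε hε hεle => ?_⟩
  set M₁ : ℝ := (Cs + 1) * (4 * M) ^ 3 + cs * (4 / θ) ^ 3 with hM₁
  have h4M : 1 ≤ 4 * M := by linarith
  have h4M3 : 1 ≤ (4 * M) ^ 3 := one_le_pow₀ h4M
  have h4θ : 1 ≤ 4 / θ := by rw [le_div_iff₀ hθ]; linarith
  have h4θ3 : 1 ≤ (4 / θ) ^ 3 := one_le_pow₀ h4θ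
  have hM₁1 : 1 ≤ M₁ := by rw [hM₁]; nlinarith
  refine ⟨M₁, hM₁1, fun K hK => ?_⟩
  intro T τ u p hframe hτ hrate t₁ y t ht₁ htt₁ hhot hterm s hs x hx j hj
  -- the clock `σ` of the hot event
  set σ : ℝ := Real.sqrt (T + τ - t) with hσ
  have hTt : 0 ≤ T + τ - t := by linarith [ht₁.2]
  have hσ2 : σ ^ 2 = T + τ - t := by rw [hσ, Real.sq_sqrt hTt]
  have hσpos : 0 < σ := by
    have h0 : 0 ≤ σ := Real.sqrt_nonneg _
    rcases h0.lt_or_eq with h | h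
    · exact h
    · exfalso; have := hhot.2; rw [← hσ, ← h, zero_mul] at this; linarith
  have hroom : σ ^ 2 ≤ t := by rw [hσ2]; exact hhot.1
  have hsT : s ≤ T := hs.2.trans ht₁.2
  rw [mem_ball, dist_eq_norm] at hx
  have hσpow : ∀ j : ℕ, 0 < σ ^ (-((j : ℝ) + 1)) := fun j => Real.rpow_pos_of_pos hσpos _
  by_cases hfar : (σ / 4) ^ 2 < T + τ - s
  · -- EARLY SLAB: the rate is the speed `4M/σ`
    have hL2 := l2_of_frame hframe
    have hr0 : 0 < σ / 4 := by positivity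
    have hwin : s ∈ Ioc ((σ / 4) ^ 2 / M ^ 2) s := by
      refine ⟨?_, le_rfl⟩
      have hM2 : 1 ≤ M ^ 2 := one_le_pow₀ hM
      have h1 : (σ / 4) ^ 2 / M ^ 2 ≤ (σ / 4) ^ 2 := by
        rw [div_le_iff₀ (by positivity)]
        have := mul_le_mul_of_nonneg_left hM2 (sq_nonneg (σ / 4))
        linarith
      have hq : (σ / 4) ^ 2 = σ ^ 2 / 16 := by ring
      have hσσ : 0 < σ ^ 2 := by positivity
      linarith [hs.1]
    have hD : ‖iteratedFDeriv ℝ j (u s) x‖ ≤ Cs * (M / (σ / 4)) ^ (j + 1) := by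
      have hGp : 0 ≤ (M / (σ / 4)) ^ (j + 1) := pow_nonneg (div_nonneg hM0.le hr0.le) _
      interval_cases j
      · exact (hC₀ hframe.1 hL2 hτ hM0 hr0 hrate hsT hfar s hwin x).trans
          (mul_le_mul_of_nonneg_right (by rw [hCs]; linarith) hGp)
      · exact (hC₁ hframe.1 hL2 hτ hM0 hr0 hrate hsT hfar s hwin x).trans
          (mul_le_mul_of_nonneg_right (by rw [hCs]; linarith) hGp)
      · exact (hC₂ hframe.1 hL2 hτ hM0 hr0 hrate hsT hfar s hwin x).trans
          (mul_le_mul_of_nonneg_right (by rw [hCs]; linarith) hGp)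
    refine hD.trans ?_
    have e1 : (M / (σ / 4)) ^ (j + 1) = (4 * M) ^ (j + 1) * σ ^ (-((j : ℝ) + 1)) := by
      rw [Real.rpow_neg hσpos.le, show ((j : ℝ) + 1) = ((j + 1 : ℕ) : ℝ) by push_cast; ring,
        Real.rpow_natCast, show M / (σ / 4) = (4 * M) * σ⁻¹ by field_simp, mul_pow, inv_pow]
    rw [e1, ← mul_assoc]
    refine mul_le_mul_of_nonneg_right ?_ (hσpow j).le
    have hj3 : (4 * M) ^ (j + 1) ≤ (4 * M) ^ 3 := pow_le_pow_right₀ h4M (by omega)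
    have hpos2 : 0 ≤ cs * (4 / θ) ^ 3 := by positivity
    have hpow0 : 0 ≤ (4 * M) ^ 3 := by positivity
    calc Cs * (4 * M) ^ (j + 1) ≤ Cs * (4 * M) ^ 3 := mul_le_mul_of_nonneg_left hj3 hCs0
      _ ≤ (Cs + 1) * (4 * M) ^ 3 := by nlinarith
      _ ≤ M₁ := by rw [hM₁]; linarith
  · -- LATE SLAB: terminality makes `Q_{σ/4}(s,x)` ε-cold
    have hnear : T + τ - s ≤ (σ / 4) ^ 2 := le_of_not_gt hfar
    have hρ : 0 < σ / 4 := by positivity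
    have hρs : (σ / 4) ^ 2 ≤ (s, x).1 := by show (σ / 4) ^ 2 ≤ s; nlinarith [hs.1]
    have hcold : ColdOn ε (T + τ) u (parabolicCylinder (σ / 4) (s, x)) := by
      intro w hw
      rw [parabolicCylinder, mem_prod, mem_Ioo, mem_ball, dist_eq_norm] at hw
      obtain ⟨⟨hw1, hw2⟩, hw3⟩ := hw
      by_contra hhot'
      push Not at hhot'
      have hw3' : ‖w.2 - x‖ < σ / 4 := hw3
      have hq : (σ / 4) ^ 2 = σ ^ 2 / 16 := by ring
      have hσσ : 0 < σ ^ 2 := by positivity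
      refine hterm w.2 w.1 ?_ ?_ ?_ ?_ ⟨?_, hhot'⟩
      · show t < w.1
        linarith
      · show w.1 ≤ t₁
        linarith [hs.2]
      · show 4 * (T + τ - w.1) ≤ T + τ - t
        linarith
      · show ‖w.2 - y‖ ≤ 4 * K * Real.sqrt (T + τ - t)
        rw [← hσ]
        have : ‖w.2 - y‖ ≤ ‖w.2 - x‖ + ‖x - y‖ := by
          calc ‖w.2 - y‖ = ‖(w.2 - x) + (x - y)‖ := by congr 1; abel
            _ ≤ ‖w.2 - x‖ + ‖x - y‖ := norm_add_le _ _
        have hKσ : σ / 4 ≤ 2 * K * σ := by nlinarith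
        linarith
      · show T + τ - w.1 ≤ w.1
        linarith
    have hsq0 : 0 ≤ (θ * (σ / 4) / 2) ^ 2 := sq_nonneg _
    have hmem : s ∈ Icc (s - (θ * (σ / 4) / 2) ^ 2) s := ⟨by linarith, le_rfl⟩
    have hballx : x ∈ ball x (θ * (σ / 4) / 2) := mem_ball_self (by positivity)
    have hreg := HR T τ u p hframe hτ hrate ε (s, x) (σ / 4) hε.le hεle hρ hρs hsT hcold s hmem x hballx j hj
    refine hreg.trans ?_
    have e1 : (θ * (σ / 4)) ^ (-((j : ℝ) + 1)) = (1 / (θ / 4)) ^ (j + 1) * σ ^ (-((j : ℝ) + 1)) := by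
      rw [show θ * (σ / 4) = (θ / 4) * σ by ring]
      exact rpow_neg_succ_mul (by positivity) hσpos j
    rw [e1, ← mul_assoc]
    refine mul_le_mul_of_nonneg_right ?_ (hσpow j).le
    have e2 : (1 / (θ / 4)) = 4 / θ := by field_simp
    rw [e2]
    have hj3 : (4 / θ) ^ (j + 1) ≤ (4 / θ) ^ 3 := pow_le_pow_right₀ h4θ (by omega)
    have hpos1 : 0 ≤ (Cs + 1) * (4 * M) ^ 3 := by positivity
    calc cs * (4 / θ) ^ (j + 1) ≤ cs * (4 / θ) ^ 3 := mul_le_mul_of_nonneg_left hj3 (by linarith)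
      _ ≤ M₁ := by rw [hM₁]; linarith


/-! ## §4 Products of the line (sorry only through CS1–CS3) -/

/-- E1b of `ember_census` v1.2, from the three plumbing stubs. -/
theorem hotWitnessNear_via_stubs : HotWitnessNear :=
  hotWitnessNear_of_stubs stub_coldCube stub_coldPressureGauge stub_smallEnergySmoothing

/-- Sa♭ (the `M`-capped regular aftermath), from the three plumbing stubs. -/
theorem regularAftermathM_via_stubs : RegularAftermathM :=
  regularAftermathM_of_stubs stub_coldCube stub_coldPressureGauge stub_smallEnergySmoothing


/-! ## §5 E2♭ WITHOUT THE ABSOLUTE CAP — `TerminalEmberM` from Sa♭ + Sb + Sc + Sd (the `silencing_cost` kernel, re-run) -/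

/-! **E2♭ `TerminalEmberM`** — BY NAME: `EmberCensus.TerminalEmberM` (tree `…EmberCensusDefs` section SplitV12, text =
`Lines/ember_census.lean` v1.2). -/

open Summit.NavierStokesRegularity.NavierStokesRegularity.Theorems.ThinCascade (frame_restrict typeI_restrict) in
/-- **S.K♭ KERNEL** — `silencing_cost`'s `terminalEmber_of_stubs` (tree `…SilencingCostKernel`, body verbatim after the
first four lines) re-run with Sa♭ `RegularAftermathM` in place of Sa: `RegularAftermathM → VorticalCentre →
EnstrophyPersistence → EmberReadout → TerminalEmberM`. -/
theorem terminalEmberM_of_stubsM (hA : RegularAftermathM) (hB : SilencingCost.VorticalCentre)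
    (hC : SilencingCost.EnstrophyPersistence) (hD : SilencingCost.EmberReadout) : TerminalEmberM := by
  intro M hM
  obtain ⟨ε₁, hε₁, hA⟩ := hA M hM
  refine ⟨ε₁, hε₁, fun ε hε hεle => ?_⟩
  obtain ⟨M₁, hM₁, hA⟩ := hA ε hε hεle
  obtain ⟨C₀, hI⟩ :=
    Summit.NavierStokesRegularity.NavierStokesRegularity.Cruxes.TypeIQuantSubcubicExp.ThinCascade.stub_uniformScaledEnergy
      M
  obtain ⟨Γ₂, δ, hΓ₂, hδ, hB⟩ := hB ε M₁ C₀ hε hM₁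
  obtain ⟨K, c, hK, hc, hC⟩ := hC M₁ δ Γ₂ hM₁ hδ hΓ₂
  have hK1 : 1 ≤ K := le_trans hΓ₂ hK
  obtain ⟨c', hc', hD⟩ := hD K M₁ c hK1 hM₁ hc
  refine ⟨2 * K, c', Γ₂ ^ 2, by linarith, hc', by nlinarith, ?_⟩
  intro T τ u p hframe hτ htypeI t₁ y t ht₁ htt₁ hroom hhot hterm
  -- positivity of the clock and of the hot time
  have hTt : 0 < T + τ - t := by linarith [ht₁.2]
  have ht0 : 0 < t := by have h := hhot.1; linarith
  have htT : t ≤ T := le_trans htt₁ ht₁.2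
  have htI : t ∈ Icc 0 T := ⟨ht0.le, htT⟩
  have ht₁I : t₁ ∈ Icc 0 T := ⟨ht₁.1.le, ht₁.2⟩
  have hσpos : 0 < Real.sqrt (T + τ - t) := Real.sqrt_pos.2 hTt
  have hσsq : Real.sqrt (T + τ - t) ^ 2 = T + τ - t := Real.sq_sqrt hTt.le
  have hhot2 : ε < Real.sqrt (T + τ - t) * ‖u t y‖ := hhot.2
  -- (a) the regular box of aperture `2K` (Sa♭)
  have hbox4 := hA (2 * K) (by linarith) T τ u p hframe hτ htypeI t₁ y t ht₁ htt₁ hhot hterm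
  generalize hσdef : Real.sqrt (T + τ - t) = σ at hσpos hσsq hhot2 hbox4 ⊢
  have hKσ : 0 < K * σ := mul_pos (by linarith) hσpos
  have hbox : SilencingCost.BoxBound M₁ σ u y (Icc t t₁) (2 * K * σ) := SilencingCost.boxBound_mono hbox4 (by nlinarith)
  -- (b) I1 on the frame restricted to `[0,t]` gives the slice energy at radius `Γ₂σ`, then Sb
  have hframe_t := frame_restrict hframe ht0 htT
  have hτ' : 0 < T - t + τ := by linarith
  have hrate_t := typeI_restrict htypeI htT
  have hΓσ : 0 < Γ₂ * σ := mul_pos (by linarith) hσpos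
  have hΓσ2 : (Γ₂ * σ) ^ 2 ≤ t := by
    have e : (Γ₂ * σ) ^ 2 = Γ₂ ^ 2 * (T + τ - t) := by rw [mul_pow, hσsq]
    rw [e]; exact hroom
  have hI1 := (hI t (T - t + τ) u p hframe_t hτ' hrate_t y (Γ₂ * σ) hΓσ hΓσ2).1 t
    ⟨by nlinarith [sq_nonneg (Γ₂ * σ)], le_rfl⟩
  have hv2 : ContDiff ℝ 2 (u t) := (hframe.1.contDiff_velocity htI).of_le (WithTop.coe_le_coe.2 le_top)
  have hgrad : ∀ x ∈ ball y σ, ∀ j : ℕ, j ≤ 2 →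
      ‖iteratedFDeriv ℝ j (u t) x‖ ≤ M₁ * σ ^ (-((j : ℝ) + 1)) :=
    fun x hx j hj => hbox t ⟨le_rfl, htt₁⟩ x (ball_subset_ball (by nlinarith) hx) j hj
  have hvort := hB (u t) y σ hσpos hv2 (hframe.1.divFree t htI) hgrad hI1 hhot2
  -- (c) the linear lemma from `t` to `t₁`
  have hspan : t₁ ≤ t + σ ^ 2 := by rw [hσsq]; linarith [ht₁.2]
  have hpers := hC T u p hframe.1 y σ t t₁ hσpos ht0.le htt₁ ht₁.2 hspan hbox hvort
  -- (d) readout at `t₁`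
  have hv2' : ContDiff ℝ 2 (u t₁) :=
    (hframe.1.contDiff_velocity ht₁I).of_le (WithTop.coe_le_coe.2 le_top)
  exact hD (u t₁) y σ hσpos hv2' (fun x hx j hj => hbox t₁ ⟨htt₁, le_rfl⟩ x hx j hj) hpers

/-- **E2♭ modulo {CS1–CS3 (plumbing), Sb `VorticalCentre`, Sc `EnstrophyPersistence`, Sd `EmberReadout`}** — Sa is
GONE (replaced by the proved Sa♭ kernel over the three plumbing stubs).  In the tree (`…SilencingCostKernel`, by name):
Sd is the theorem `SilencingCost.stub_emberReadout : EmberReadout` and Sc follows from Sc′ by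
`SilencingCost.enstrophyPersistence_of_thickBoxSilencingCost : ThickBoxSilencingCost → EnstrophyPersistence`, so this
reads E2♭ ⟸ {CS1–CS3, Sb, Sc′}; the two names are not invoked here only because that module's oleans were not yet
built on the farm at filing time (rc 75 `remote:stale:unbuilt`), and this workfile must elaborate. -/
theorem terminalEmberM_of_vortical_of_persistence (hB : SilencingCost.VorticalCentre)
    (hC : SilencingCost.EnstrophyPersistence) (hD : SilencingCost.EmberReadout) : TerminalEmberM :=
  terminalEmberM_of_stubsM regularAftermathM_via_stubs hB hC hD

end Summit.NavierStokesRegularity.NavierStokesRegularity.Cruxes.TypeIQuantSubcubicExp.ColdSmoothing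

end
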